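import Mathlib
import Summits.Ventures.HodgeRepro.Tier4.Line4.LevelPrime
import Summits.Ventures.HodgeRepro.Tier4.Line4.LevelSplit
import Summits.Ventures.HodgeRepro.Tier4.Common.MixedPlane

/-!
# Tier4/Line4/LevelPrimeNonsplit — C-L4-LEVELPRIME-NONSPLIT: the level prime of the (7b) chain drawn with BOTH clauses
(integrality of `γ₀` above `p` AND non-splitting above `p`) from the PRINT-class infinitude of non-split primes

Blind re-derivation cell `pub-hodge-repro`, Tier 4 «prove the step» (README §9–§10), LINE L4, seat t4-L1-p2 (g6; plan-4
g7's S16257 (3) `exists_prime_integral_at` in the shape L2-p2 g6's S16289 answer leaves: the chain's `p` carries `hp hγ₀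
hns`, so the prime is drawn from the non-split primes, which are a PRINT).  Tree path
`lean/Summits/Ventures/HodgeRepro/Tier4/Line4/LevelPrimeNonsplit.lean`.  Imports L1-p1's `Line4/LevelPrime`
(`badPrimes`, `finite_badPrimes` — `exists_prime_integral_at` IS its `exists_levelPrime`, nothing re-proved), L2-p1's
`Line4/LevelSplit` (`placesAbove`), typer-2's `Common/MixedPlane` (`QuadData`).  Mathlib-level; no `def`; ONE displayed
hypothesis of print class (`hinf`, below), NOT proved here.

WHAT.  `exists_levelPrime_of_infinite`: for any `γ₀ ∈ G(𝔸)` and any property `P` of rational primes holding for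
INFINITELY many of them, some prime `p` with `P p` lies below no bad place of `γ₀` (`finite_badPrimes`: the rational primes
below a place where an entry of `γ₀` or `γ₀⁻¹` is non-integral are finitely many; an infinite set minus a finite set is
non-empty).  `exists_levelPrime_nonsplit` is its instance at `P p := ∀ v ∈ placesAbove p, ¬ IsSquare (t² − 4n)_v`, the
(E1) local clause of the (7b) chain (`hns` of TailSeesawDomain S16258 / S16287): the FOUR binders `p hp hγ₀ hns` of the
chain's deepest layer become ONE binder `hinf`, the infinitude of the rational primes every place of `k` above which is
non-split in `E = k(√(t² − 4n))`.

THE PRINT (`hinf`; displayed, never proved in this cell): Chebotarev density (Neukirch, Algebraic Number Theory, VII (13.4))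
for the Galois closure `N/ℚ` of the CM field `E`, conjugacy class `{c}` with `c` = complex conjugation — central in
`Gal(N/ℚ)` BECAUSE `E` is CM — gives rational primes `p` of density `1/[N:ℚ] > 0` with Frobenius `c`: `p` splits completely
in `N⁺ = N^c ⊇ k` and every prime of `N⁺` above `p` is inert in `N`, so every place `v` of `k` above `p` is inert in `E`,
i.e. `t² − 4n ∉ (k_v)²`.  The ELEMENTARY «infinitely many primes of `k` inert in `E/k`» (Neukirch VII.13, Lang ANT VIII §4)
is NOT enough: it produces a prime `𝔭` of `k`, not a rational `p` ALL of whose `k`-places are non-split; for a non-CM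
quadratic extension `k(√D)/k` the rational-prime statement can fail (`k` cubic with `S₄`-closure, `D` its discriminant: no
conjugacy class of `S₄` lies in `S₃ \ A₃`, so every rational prime has a split place).

Nothing here says anything about the status of the Hodge conjecture for CM abelian varieties, which is NOT proved
(HC_CM is NOT proved by anyone in this repository).
-/

set_option autoImplicit false

noncomputable section

namespace Summit.Ventures.HodgeRepro.Tier4.Line4

open Summit.Ventures.HodgeRepro.Tier4 Summit.Ventures.HodgeRepro.Tier4.Common NumberField IsDedekindDomain

open scoped NumberField

section LevelPrimeNonsplit

variable {k : Type} [Field k] [NumberField k] (W : PlaneData k)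

/-- **The level prime drawn from an infinite set of primes**: if infinitely many rational primes satisfy `P`, one of them
lies below no bad place of `γ₀` (`finite_badPrimes`), i.e. `γ₀` and `γ₀⁻¹` are integral at every place above it. -/
theorem exists_levelPrime_of_infinite (γ₀ : GA W) {P : ℕ → Prop} (hinf : {p : ℕ | p.Prime ∧ P p}.Infinite) :
    ∃ p : ℕ, p.Prime ∧ (∀ v : HeightOneSpectrum (𝓞 k), natSize k v p < 1 → ∀ i j : Fin 4,
      Valued.v (finPart k (GA.mat W γ₀ i j) v) ≤ 1 ∧ Valued.v (finPart k (GA.mat W γ₀⁻¹ i j) v) ≤ 1) ∧ P p := by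
  obtain ⟨p, ⟨hp, hP⟩, hnb⟩ := (hinf.sdiff (finite_badPrimes W γ₀)).nonempty
  refine ⟨p, hp, fun v hv i j => ?_, hP⟩
  by_contra hbad
  exact hnb ⟨hp, v, ⟨i, j, hbad⟩, hv⟩

/-- **C-L4-LEVELPRIME-NONSPLIT — the `p`-binder of the (7b) chain closed modulo the print**: from the infinitude `hinf` of
the rational primes `p` every place of `k` above which is non-split in `E = k(√(t² − 4n))` (Chebotarev at the class of
complex conjugation — a PRINT, displayed, not proved here), there is a rational prime `p` with `γ₀`, `γ₀⁻¹` integral at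
every place above `p` (`hγ₀` of the chain) AND the (E1) local clause `hns` at every place above `p`. -/
theorem exists_levelPrime_nonsplit (γ₀ : GA W) (q : QuadData k)
    (hinf : {p : ℕ | p.Prime ∧ ∀ v ∈ placesAbove (k := k) p,
      ¬ IsSquare (algebraMap k (v.adicCompletion k) (q.t ^ 2 - 4 * q.n))}.Infinite) :
    ∃ p : ℕ, p.Prime ∧ (∀ v : HeightOneSpectrum (𝓞 k), natSize k v p < 1 → ∀ i j : Fin 4,
      Valued.v (finPart k (GA.mat W γ₀ i j) v) ≤ 1 ∧ Valued.v (finPart k (GA.mat W γ₀⁻¹ i j) v) ≤ 1) ∧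
      ∀ v ∈ placesAbove (k := k) p, ¬ IsSquare (algebraMap k (v.adicCompletion k) (q.t ^ 2 - 4 * q.n)) :=
  exists_levelPrime_of_infinite W γ₀ hinf

end LevelPrimeNonsplit

end Summit.Ventures.HodgeRepro.Tier4.Line4

end
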